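import Summits.Ventures.HodgeRepro.CyclicFourier

/-!
# Fourier analysis on `ℤ/2^(a+1)` for a CM profile: pairing or constant

Blind re-derivation cell `pub-hodge-repro`, seat `p1` (gen 11).  The toolkit of gen 8 (`CyclicFourier.lean`) is
extended by the one lemma the product groups `C_{2^(a+1)} × C₂` need (`TwoPowerTimesTwoNoSingleClass.lean`).

A *CM profile* on `ℤ/N`, `N = 2m`, is a function `P : ℤ/N → ℂ` with `P(x + m) = 2 − P(x)`; the profiles that occur
are the push-forwards of the indicator of a CM type along a surjection with a kernel of order `2` (each fibre has
two points, so `P ∈ {0, 1, 2}` and the CM condition of the type becomes the relation above).  A `SumTwo` quadruple of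
Galois twists pushes forward to `∑ᵢ P(x − zᵢ) = 4` for every `x`.

**Theorem** (`pairing_or_const`).  Let `N = 2 · 2^a`, `P` a CM profile on `ℤ/N` and `z₀, …, z₃ ∈ ℤ/N` with
`∑ᵢ P(x − zᵢ) = 4` for all `x`.  Then either `P ≡ 1`, or the four points split into two pairs each differing by
`m = 2^a`: `(z₀ − z₁ = m ∧ z₂ − z₃ = m) ∨ (z₀ − z₂ = m ∧ z₁ − z₃ = m) ∨ (z₀ − z₃ = m ∧ z₁ − z₂ = m)`.

Proof.  `𝓕P(k) = 0` for even `k ≠ 0` (`dft_eq_zero_of_even_of_half`, from the profile relation) and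
`(∑ᵢ ψ(−zᵢ k)) · 𝓕P(k) = 0` for `k ≠ 0` (`char_sum_mul_dft_of_sum_four`).  If `𝓕P` vanishes off `0`, `P` is
constant (`const_of_dft_eq_zero`), hence `≡ 1` by the profile relation.  Otherwise some odd `k` carries
`𝓕P(k) ≠ 0` — odd because `ψ(mk) = −1` (`odd_val_of_char_half_mul`) — and the vanishing sum of four roots of
unity splits into two antipodal pairs (`four_roots_pairs`, the refinement of gen 8's `four_roots`):
`ψ((zᵢ − zⱼ) k) = −1` on both pairs.  Since `N` is a power of `2`, an odd `k` is a unit, and `ψ(d k) = −1`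
forces `d = m` (`eq_half_of_char_mul`).
-/

set_option autoImplicit false

open Finset AddChar ZMod
open scoped Pointwise

namespace HodgeRepro.CyclicQuad

variable {N : ℕ} [NeZero N]

/-! ### Four roots of unity summing to zero: BOTH antipodal pairs -/

/-- `ψ(y − x) = −1` exactly when `ψ y = −ψ x`. -/
theorem stdAddChar_sub_eq_neg_one_iff (x y : ZMod N) :
    stdAddChar (y - x) = -1 ↔ stdAddChar y = - stdAddChar x := by
  have e : stdAddChar y = stdAddChar x * stdAddChar (y - x) := by
    rw [← map_add_eq_mul]; congr 1; abel
  constructor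
  · intro h1; rw [e, h1, mul_neg_one]
  · intro h1
    have h2 : stdAddChar x * stdAddChar (y - x) = stdAddChar x * (-1) := by
      rw [← e, h1, mul_neg_one]
    exact mul_left_cancel₀ (stdAddChar_ne_zero x) h2

/-- **Both antipodal pairs.**  A vanishing sum `ψ a + ψ b + ψ c + ψ d = 0` of four character values splits into
two antipodal pairs: `{a, b}, {c, d}` or `{a, c}, {b, d}` or `{a, d}, {b, c}`. -/
theorem four_roots_pairs {a b c d : ZMod N}
    (h : stdAddChar a + stdAddChar b + stdAddChar c + stdAddChar d = 0) :
    (stdAddChar (b - a) = -1 ∧ stdAddChar (d - c) = -1) ∨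
    (stdAddChar (c - a) = -1 ∧ stdAddChar (d - b) = -1) ∨
    (stdAddChar (d - a) = -1 ∧ stdAddChar (c - b) = -1) := by
  rcases four_roots h with h1 | h1 | h1
  · refine Or.inl ⟨h1, ?_⟩
    have h2 := (stdAddChar_sub_eq_neg_one_iff a b).mp h1
    rw [stdAddChar_sub_eq_neg_one_iff]
    linear_combination h - h2
  · refine Or.inr (Or.inl ⟨h1, ?_⟩)
    have h2 := (stdAddChar_sub_eq_neg_one_iff a c).mp h1
    rw [stdAddChar_sub_eq_neg_one_iff]
    linear_combination h - h2
  · refine Or.inr (Or.inr ⟨h1, ?_⟩)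
    have h2 := (stdAddChar_sub_eq_neg_one_iff a d).mp h1
    rw [stdAddChar_sub_eq_neg_one_iff]
    linear_combination h - h2

/-! ### Profiles: the even coefficients vanish, the twisted sum kills the odd ones -/

/-- The profile relation `P(x + m) = 2 − P(x)` kills `𝓕P(k)` at every `k ≠ 0` with `ψ(mk) = 1`. -/
theorem dft_eq_zero_of_even_of_half {m : ℕ} (P : ZMod N → ℂ) (hP : ∀ x, P (x + m) = 2 - P x)
    (k : ZMod N) (hk : k ≠ 0) (hmk : stdAddChar ((m : ZMod N) * k) = 1) : ZMod.dft P k = 0 := by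
  have h1 : (fun x => P (x - (-(m : ZMod N)))) = fun x => 2 - P x := by
    funext x; rw [sub_neg_eq_add, hP]
  have h2 := dft_shift P (-(m : ZMod N)) k
  rw [h1, neg_mul, neg_neg, hmk, one_mul] at h2
  have h3 : ZMod.dft (fun x => 2 - P x) k = - ZMod.dft P k := by
    have e : (fun x : ZMod N => 2 - P x) = (fun _ => (2 : ℂ)) - P := by
      funext x; simp
    rw [e, map_sub, Pi.sub_apply, dft_const 2 k hk, zero_sub]
  rw [h3] at h2
  have h4 : (2 : ℂ) * ZMod.dft P k = 0 := by linear_combination -h2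
  exact (mul_eq_zero.mp h4).resolve_left two_ne_zero

/-- `∑ᵢ P(x − zᵢ) = 4` for every `x` gives `(∑ᵢ ψ(−zᵢ k)) · 𝓕P(k) = 0` for every `k ≠ 0`. -/
theorem char_sum_mul_dft_of_sum_four (P : ZMod N → ℂ) (z : Fin 4 → ZMod N)
    (hs : ∀ x, ∑ i : Fin 4, P (x - z i) = 4) (k : ZMod N) (hk : k ≠ 0) :
    (∑ i : Fin 4, stdAddChar (-(z i * k))) * ZMod.dft P k = 0 := by
  have h1 : (fun x => ∑ i : Fin 4, P (x - z i)) = fun _ => (4 : ℂ) := funext hs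
  have h2 : ZMod.dft (fun x => ∑ i : Fin 4, P (x - z i)) k =
      ∑ i : Fin 4, stdAddChar (-(z i * k)) * ZMod.dft P k := by
    have e : (fun x => ∑ i : Fin 4, P (x - z i)) = ∑ i : Fin 4, (fun x => P (x - z i)) := by
      funext x; simp only [Finset.sum_apply]
    rw [e, map_sum, Finset.sum_apply]
    exact Finset.sum_congr rfl (fun i _ => dft_shift P (z i) k)
  rw [Finset.sum_mul, ← h2, h1, dft_const 4 k hk]

/-- If `𝓕P` vanishes away from `0`, `P` is constant. -/
theorem const_of_dft_eq_zero (P : ZMod N → ℂ) (h : ∀ k, k ≠ 0 → ZMod.dft P k = 0) (x : ZMod N) :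
    P x = P 0 := by
  have hper : ∀ y, P (y + 1) = P y := by
    apply periodic_of_dft
    intro k hk
    by_cases hk0 : k = 0
    · rw [hk0, mul_zero, map_zero_eq_one]
    · exact absurd (h k hk0) hk
  have hc' : ∀ n : ℕ, P (n : ZMod N) = P 0 := by
    intro n
    induction n with
    | zero => rw [Nat.cast_zero]
    | succ n ih => rw [Nat.cast_succ, hper, ih]
  rw [← ZMod.natCast_zmod_val x, hc' x.val]

/-! ### Odd `k` on `ℤ/2^(a+1)`: `ψ(d k) = −1` forces `d = 2^a` -/

/-- `ψ(N/2 · k) = −1` forces `k.val` odd (`N = 2m`). -/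
theorem odd_val_of_char_half_mul {m : ℕ} (hN : N = 2 * m) (k : ZMod N)
    (hk : stdAddChar ((m : ZMod N) * k) = -1) : Odd k.val := by
  have h1 : stdAddChar ((m : ZMod N) * k) = (-1 : ℂ) ^ k.val := by
    conv_lhs => rw [← ZMod.natCast_zmod_val k, mul_comm, ← nsmul_eq_mul, map_nsmul_eq_pow,
      stdAddChar_half hN]
  rw [h1] at hk
  by_contra hodd
  rw [Nat.not_odd_iff_even] at hodd
  rw [hodd.neg_one_pow] at hk
  norm_num at hk

/-- On `ℤ/2^(a+1)`: `ψ(2^a k) = −1` (so `k` is odd, a unit) and `ψ(d k) = −1` force `d = 2^a`. -/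
theorem eq_half_of_char_mul {a : ℕ} (hN : N = 2 * 2 ^ a) (k : ZMod N)
    (hk : stdAddChar (((2 ^ a : ℕ) : ZMod N) * k) = -1) (d : ZMod N)
    (hd : stdAddChar (d * k) = -1) : d = ((2 ^ a : ℕ) : ZMod N) := by
  have hodd : Odd k.val := odd_val_of_char_half_mul hN k hk
  have hcop : Nat.Coprime k.val N := by
    have h2 : Nat.Coprime k.val (2 ^ (a + 1)) :=
      (Nat.coprime_pow_right_iff (Nat.succ_pos a) _ _).mpr (Nat.coprime_two_right.mpr hodd)
    have hN' : 2 ^ (a + 1) = N := by rw [hN]; ring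
    exact hN' ▸ h2
  have hu : ((ZMod.unitOfCoprime k.val hcop : (ZMod N)ˣ) : ZMod N) = k := by
    rw [ZMod.coe_unitOfCoprime, ZMod.natCast_zmod_val]
  have h1 : d * k = ((2 ^ a : ℕ) : ZMod N) := (stdAddChar_eq_neg_one_iff hN (d * k)).mp hd
  have h2 : ((2 ^ a : ℕ) : ZMod N) * k = ((2 ^ a : ℕ) : ZMod N) :=
    (stdAddChar_eq_neg_one_iff hN _).mp hk
  have h3 : d * k = ((2 ^ a : ℕ) : ZMod N) * k := by rw [h1, h2]
  rw [← hu] at h3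
  exact (Units.mul_left_inj _).mp h3

/-! ### The main lemma -/

/-- **Pairing or constant.**  A CM profile `P` on `ℤ/(2 · 2^a)` with `∑ᵢ P(x − zᵢ) = 4` for all `x` is either
`≡ 1`, or the four points `zᵢ` split into two pairs each differing by `2^a`. -/
theorem pairing_or_const {a : ℕ} (hN : N = 2 * 2 ^ a) (P : ZMod N → ℂ)
    (hP : ∀ x, P (x + ((2 ^ a : ℕ) : ZMod N)) = 2 - P x) (z : Fin 4 → ZMod N)
    (hs : ∀ x, ∑ i : Fin 4, P (x - z i) = 4) :
    (∀ x, P x = 1) ∨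
    ((z 0 - z 1 = ((2 ^ a : ℕ) : ZMod N) ∧ z 2 - z 3 = ((2 ^ a : ℕ) : ZMod N)) ∨
     (z 0 - z 2 = ((2 ^ a : ℕ) : ZMod N) ∧ z 1 - z 3 = ((2 ^ a : ℕ) : ZMod N)) ∨
     (z 0 - z 3 = ((2 ^ a : ℕ) : ZMod N) ∧ z 1 - z 2 = ((2 ^ a : ℕ) : ZMod N))) := by
  by_cases h : ∃ k, k ≠ 0 ∧ ZMod.dft P k ≠ 0
  swap
  · left
    have h' : ∀ k, k ≠ 0 → ZMod.dft P k = 0 :=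
      fun k hk => by_contra fun h1 => h ⟨k, hk, h1⟩
    intro x
    have hc := const_of_dft_eq_zero P h'
    have h1 := hP 0
    rw [hc (0 + ((2 ^ a : ℕ) : ZMod N))] at h1
    have h2 : P 0 = 1 := by linear_combination h1 / 2
    rw [hc x, h2]
  · right
    obtain ⟨k, hk0, hk⟩ := h
    have hsum : ∑ i : Fin 4, stdAddChar (-(z i * k)) = 0 :=
      (mul_eq_zero.mp (char_sum_mul_dft_of_sum_four P z hs k hk0)).resolve_right hk
    have hmk : stdAddChar (((2 ^ a : ℕ) : ZMod N) * k) = -1 := by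
      have hne : stdAddChar (((2 ^ a : ℕ) : ZMod N) * k) ≠ 1 :=
        fun h1 => hk (dft_eq_zero_of_even_of_half P hP k hk0 h1)
      have hsq : stdAddChar (((2 ^ a : ℕ) : ZMod N) * k) ^ 2 = 1 := by
        rw [← map_nsmul_eq_pow, nsmul_eq_mul, ← mul_assoc]
        have e : ((2 : ℕ) : ZMod N) * ((2 ^ a : ℕ) : ZMod N) = 0 := by
          rw [← Nat.cast_mul, ← hN, ZMod.natCast_self]
        rw [e, zero_mul, map_zero_eq_one]
      rcases sq_eq_one_iff.mp hsq with h1 | h1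
      · exact absurd h1 hne
      · exact h1
    have conv : ∀ i j : Fin 4, stdAddChar (-(z j * k) - -(z i * k)) = -1 →
        z i - z j = ((2 ^ a : ℕ) : ZMod N) := by
      intro i j h
      apply eq_half_of_char_mul hN k hmk
      rw [show (z i - z j) * k = -(z j * k) - -(z i * k) by ring]
      exact h
    rw [Fin.sum_univ_four] at hsum
    rcases four_roots_pairs hsum with ⟨h1, h2⟩ | ⟨h1, h2⟩ | ⟨h1, h2⟩
    · exact Or.inl ⟨conv 0 1 h1, conv 2 3 h2⟩
    · exact Or.inr (Or.inl ⟨conv 0 2 h1, conv 1 3 h2⟩)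
    · exact Or.inr (Or.inr ⟨conv 0 3 h1, conv 1 2 h2⟩)

end HodgeRepro.CyclicQuad
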